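import Summits.CriticalPhenomena.SAWScalingLimit.Theorems.SAWDevelopingMapHexConjectureKPDefs
import HarnessLib

/-!
# Crux `HexConjecture` (stmt-CriticalPhenomena-0808), line `root-locality-replaces-loewner`:
the parafermionic identity of the clipped triangle (Krachun–Panagiotis, proof of Lemma 3.2)

Landing target:
`Summits/CriticalPhenomena/SAWScalingLimit/Theorems/SAWDevelopingMapHexConjectureKPClip.lean`
(`--supports stmt-CriticalPhenomena-0808`; registered sub-goal `stub_kp_clip_identity`).

Krachun–Panagiotis (arXiv:2310.17299), proof of Lemma 3.2: "The contour integral along the boundary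
of the domains `Trap_{2i+1,x}` and `Tria_{2i+1,x}` being `0` gives
`cos(3π/8) F^L + cos(π/8) F^R + cos(π/8) F^T + cos(π/4) F^B = 1` and `cos(3π/8) A + cos(π/8) D = 1`.
Thus `F^B = (cos(3π/8)(A − F^L) + cos(π/8)(D − F^R − F^T)) / cos(π/4)` … `A − F^L ≥ 0` since any walk
contained in `Trap` is also contained in `Tria`; and `D − F^R − F^T ≥ D⁻`, since any walk contributing
to `D⁻` is contained in `Tria` but not in `Trap`. This implies `F^B ≥ (cos(π/8)/cos(π/4)) D⁻`."

In the own frame of the attached triangle (`SAWDevelopingMapHexConjectureKPDefs.lean`) the trapezoid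
is the CLIPPED TRIANGLE `clipV i h = T_i ∩ {x₀ ≤ h}`, with four boundary classes: the base
`IsAlphaDart` (KP's `L`, winding `∓π`, weight `cos(3π/8)`), the left and right sides `IsLeftDart i`,
`IsRightDart i` (KP's `T`, `R`, windings `±π/3`, weight `cos(π/8)`) and the cut `IsClipDart h` (KP's
`B`; it has exactly the shape of Duminil-Copin–Smirnov's right `ε̄`-cut, winding `-2π/3`, weight
`cos(π/4)`).  We prove, following the template `HV.tri_identity` (`HexSAWTriangle.lean`):

* `not_mem_clipV_iff_classes`, `clip_boundary_iff` — the boundary of `C(i,h)` is base ∪ left ∪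
  right ∪ cut;
* `pturn_of_isClipDart` (`= -2`) and `boundaryTerm_re_of_isClipDart` (`Re = cos(π/4)`) — the
  right-cut branches of `HV.pturn_of_isEpsDart` / `HV.boundaryTerm_re_of_isEpsDart`;
* `clip_identity` — `cos(3π/8)·clipA + cos(π/8)·(clipDl + clipDr) + cos(π/4)·clipE = 1`;
* `triDr_eq_clipDr_add_triDminus` — the right exits of `T_i` split into those staying in the
  clipped triangle (`clipDr`) and those visiting a cell beyond the cut (`triDminus`, KP's `D⁻`);
* `triDminus_le_clipE` — `cos(π/8)·triDminus ≤ cos(π/4)·clipE`, by subtracting the two identities;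
* the registered sub-goal `stub_kp_clip_identity` (the conjunction of the three).
-/

noncomputable section

open Finset
open Literature.Probability.RandomPlanarGeometry.SAW Literature.Probability.RandomPlanarGeometry.SAW.HV

namespace Summit.CriticalPhenomena.SAWScalingLimit.Theorems.HexConjecture.RootLocality

open Real

/-! ### The boundary of the clipped triangle -/

/-- The clipped triangle lies in the upper half-plane. [cite: KrachunPanagiotis2026, §3.2 (Trap_{2i+1,x} ⊆ 𝕌)] -/
theorem clipV_upper {i h : ℕ} : ∀ w ∈ clipV i h, 0 ≤ w.2.1 := fun _ hw => (mem_clipV_iff.1 hw).1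

/-- The origin (the cell entered through the root mid-edge) is a vertex of every clipped triangle.
[cite: KrachunPanagiotis2026, §3.2] -/
theorem hvOrigin_mem_clipV (i h : ℕ) : hvOrigin ∈ clipV i h := by
  rw [mem_clipV_iff]; simp [hvOrigin]

/-- On `C(i,h)`, `(pos x).1 ≤ 3h + 2`: the whole clipped triangle lies behind the cut.
[cite: KrachunPanagiotis2026, §3.2] -/
theorem pos_fst_le_of_mem_clipV {i h : ℕ} {x : HV} (hx : x ∈ clipV i h) :
    (pos x).1 ≤ 3 * h + 2 := by
  have h4 := (mem_clipV_iff.1 hx).2.2.2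
  obtain ⟨a, b, c⟩ := x; cases c <;> simp [pos] at h4 ⊢ <;> omega

/-- **The boundary of `C(i,h)` is base ∪ left side ∪ right side ∪ cut**: a half-edge from a vertex
of the clipped triangle leaves it iff it is of class `α`, left, right or cut.
[cite: KrachunPanagiotis2026, proof of Lemma 3.2 (F^L, F^T, F^R, F^B)] -/
theorem not_mem_clipV_iff_classes {i h : ℕ} {v u : HV} (hv : v ∈ clipV i h)
    (hadj : hvGraph.Adj v u) :
    u ∉ clipV i h ↔ IsAlphaDart (v, u) ∨ IsLeftDart i (v, u) ∨ IsRightDart i (v, u) ∨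
      IsClipDart h (v, u) := by
  obtain ⟨a, b, c⟩ := v
  obtain ⟨a', b', c'⟩ := u
  rw [mem_clipV_iff] at hv ⊢
  cases c <;> cases c' <;> simp only [hvGraph_adj, AdjRel] at hadj <;> simp at hadj <;>
    rcases hadj with ⟨rfl, rfl⟩ | ⟨rfl, rfl⟩ | ⟨rfl, rfl⟩ <;>
    simp [IsAlphaDart, IsLeftDart, IsRightDart, IsClipDart, bit] at hv ⊢ <;> omega

/-- The cut class is disjoint from the three classes of `T_i` (those leave from an up-cell).
[cite: KrachunPanagiotis2026, proof of Lemma 3.2] -/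
theorem not_isClipDart_of_eq_false {h : ℕ} {d : HV × HV} (hd : d.1.2.2 = false) :
    ¬ IsClipDart h d := fun h' => by
  rw [h'.2.1] at hd; exact Bool.noConfusion hd

/-- For a walk of `C(i,h)` from `a`: it is a nontrivial walk to a boundary mid-edge iff its final
half-edge is of class `α`, left, right or cut. [cite: KrachunPanagiotis2026, proof of Lemma 3.2] -/
theorem clip_boundary_iff {i h : ℕ} {P : List HV} (hP : IsMidWalk (clipV i h) P) :
    (P ≠ [wOut, hvOrigin] ∧ (finalDart P).2 ∉ clipV i h) ↔
      (IsAlphaDart (finalDart P) ∨ IsLeftDart i (finalDart P) ∨ IsRightDart i (finalDart P) ∨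
        IsClipDart h (finalDart P)) := by
  rcases hP.trivial_or_exists with rfl | ⟨l, u, hl, rfl⟩
  · simp only [ne_eq, not_true_eq_false, false_and, finalDart_trivial, false_iff, not_or]
    refine ⟨fun hc => ?_, fun hc => ?_, fun hc => ?_, fun hc => ?_⟩
    · have := hc.1; simp [wOut] at this
    · have := hc.2.1; simp [wOut] at this
    · have := hc.2.1; simp [wOut] at this
    · have := hc.2.2; simp [wOut, hvOrigin] at this
  · obtain ⟨-, -, hadj, hlV, -, -⟩ := (isMidWalk_cons_append_iff _ hl u).1 hP
    rw [finalDart_cons_append hl]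
    rw [← not_mem_clipV_iff_classes (hlV _ (List.getLast_mem hl)) hadj]
    have hne : wOut :: (l ++ [u]) ≠ [wOut, hvOrigin] := by
      intro he
      have := congrArg List.length he
      simp only [List.length_cons, List.length_append, List.length_nil] at this
      exact hl (List.eq_nil_of_length_eq_zero (by omega))
    exact ⟨fun hc => hc.2, fun hc => ⟨hne, hc⟩⟩

/-! ### Winding and boundary term on the cut -/

/-- **Winding to the cut is `-2π/3`**: a self-avoiding walk of `C(i,h)` from `a` leaving through the
cut `x₀ = h ∣ h+1` turns in total by `-2π/3` (`pturn = -2`) — the cut half-edges have the shape of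
Duminil-Copin–Smirnov's right `ε̄`-cut ("the winding … to `ε̄` is `-2π/3`"): Hopf's formula with the
rotation `ω² = j`; the whole clipped triangle lies behind the cut.
[cite: DuminilCopinSmirnov2012, proof of Lemma 2] -/
theorem pturn_of_isClipDart {i h : ℕ} {P : List HV} (hP : IsMidWalk (clipV i h) P)
    (hc : IsClipDart h (finalDart P)) : pturn P = -2 := by
  rcases hP.trivial_or_exists with rfl | ⟨l, u, hl, rfl⟩
  · exfalso; rw [finalDart_trivial] at hc; have := hc.2.2; simp [wOut, hvOrigin] at this
  rw [finalDart_cons_append hl] at hc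
  obtain ⟨h1, h2, h3⟩ := hc
  dsimp only at h1 h2 h3
  obtain ⟨-, -, -, hlV, -, -⟩ := (isMidWalk_cons_append_iff _ hl u).1 hP
  set v := l.getLast hl with hv
  have hvV : v ∈ clipV i h := hlV _ (List.getLast_mem hl)
  have hb := (mem_clipV_iff.1 hvV).1
  have hposv : pos v = (3 * v.1 + 2, 3 * v.2.1 + 2) := by simp [pos, h2]
  have hposu : pos u = (3 * v.1 + 4, 3 * v.2.1 + 1) := by
    rw [h3]; simp [pos]; ring
  have key := pturn_walk_eq clipV_upper hl hP ?_ ?_ ?_ (pow_ne_zero 2 omg_ne_zero) (c := omg ^ 2)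
    ?_ ?_
  · apply int_eq_of_pi_div_three_mul
    rw [key, arg_omg_sq_mul]
    · push_cast; ring
    · rw [hposu, pos_wOut]; simp only [Prod.fst_sub]; omega
    · rw [hposu, pos_wOut]; simp only [Prod.snd_sub]; omega
  · intro hu
    have := (mem_clipV_iff.1 hu).2.2.2
    rw [h3] at this; dsimp only at this; omega
  · rw [h3]; simp [wOut]
  · rw [hposu]; dsimp only; omega
  · have him : ∀ X : ℤ × ℤ, (omg ^ 2 * emb X).im = (X.1 : ℤ) * (Real.sqrt 3 / 2) := by
      intro X; rw [mul_comm, ← emb_rot2, emb_im]; simp [rot2]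
    refine forall_mem_walk ?_ (fun x hx => ?_) ?_
    · rw [him, hposu, pos_wOut]; simp only [Prod.fst_sub]
      have : (0 : ℝ) ≤ ((3 * v.1 + 4 - 2 : ℤ) : ℝ) := by exact_mod_cast (by omega)
      positivity
    · rw [him, hposu]; simp only [Prod.fst_sub]
      have h4 := pos_fst_le_of_mem_clipV (hlV x hx)
      have : (0 : ℝ) ≤ ((3 * v.1 + 4 - (pos x).1 : ℤ) : ℝ) := by exact_mod_cast (by omega)
      positivity
    · rw [sub_self, him]; simp
  · rw [hposu, hposv,
      show ((3 * v.1 + 4, 3 * v.2.1 + 1) - (3 * v.1 + 2, 3 * v.2.1 + 2) : ℤ × ℤ) = (2, -1) by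
        simp only [Prod.mk_sub_mk, Prod.mk.injEq]; constructor <;> ring,
      mul_comm, ← emb_rot2]
    exact arg_emb_neg_one_two

/-- **Boundary term on the cut**: direction `2 - ω = j̄ e₀`, winding `-2π/3`: the real part of the
term is `cos(π/4)` (Duminil-Copin–Smirnov's `c_ε`; KP's weight of `F^B`).
[cite: KrachunPanagiotis2026, proof of Lemma 3.2 (cos(π/4) F^B)] -/
theorem boundaryTerm_re_of_isClipDart {i h : ℕ} {P : List HV} (hP : IsMidWalk (clipV i h) P)
    (hc : IsClipDart h (finalDart P)) :
    (edir (finalDart P).1 (finalDart P).2 * lam ^ pturn P / emb (-1, 2)).re = Real.cos (π / 4) := by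
  have h0 := pturn_of_isClipDart hP hc
  rcases hP.trivial_or_exists with rfl | ⟨l, u, hl, rfl⟩
  · exfalso; rw [finalDart_trivial] at hc; have := hc.2.2; simp [wOut, hvOrigin] at this
  rw [h0, finalDart_cons_append hl]
  rw [finalDart_cons_append hl] at hc
  obtain ⟨-, h2, h3⟩ := hc
  dsimp only at h2 h3 ⊢
  have hposv : pos (l.getLast hl) = (3 * (l.getLast hl).1 + 2, 3 * (l.getLast hl).2.1 + 2) := by
    simp [pos, h2]
  have he : edir (l.getLast hl) u = -omg * emb (-1, 2) := by
    rw [edir, h3, hposv, ← emb_two_neg_one]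
    simp only [pos, Bool.false_eq_true, if_false]
    congr 1; simp only [Prod.mk_sub_mk, Prod.mk.injEq]; constructor <;> ring
  have h32 : -omg = lam ^ (32 : ℤ) := by
    rw [show (32 : ℤ) = 16 + 16 by norm_num, zpow_add₀ lam_ne_zero, lam_zpow_sixteen, ← omg_sq,
      ← pow_add, show 2 + 2 = 3 + 1 by norm_num, pow_add, omg_pow_three]; ring
  rw [he, mul_div_right_comm, mul_div_assoc, div_self emb_neg_one_two_ne_zero, mul_one,
    h32, ← zpow_add₀ lam_ne_zero, lam_zpow_re, show (((32 + -2 : ℤ)) : ℝ) = 30 by norm_num]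
  exact cos_thirty_mul_θ₅

/-! ### The identity of the clipped triangle -/

/-- **Krachun–Panagiotis, proof of Lemma 3.2, the trapezoid identity**:
`cos(3π/8) F^L + cos(π/8) F^R + cos(π/8) F^T + cos(π/4) F^B = 1` — in the frame of the attached
triangle, `cos(3π/8)·clipA + cos(π/8)·(clipDl + clipDr) + cos(π/4)·clipE = 1`.  From the summed vertex
relation `HV.boundary_sum` over `V(C(i,h))`, the classification `clip_boundary_iff` and the four
boundary windings `∓π`, `+π/3`, `-π/3`, `-2π/3`.
[cite: KrachunPanagiotis2026, proof of Lemma 3.2 ("The contour integral along the boundary of Trap_{2i+1,x}")] -/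
theorem clip_identity (i h : ℕ) :
    Real.cos (3 * π / 8) * clipA i h + Real.cos (π / 8) * (clipDl i h + clipDr i h) +
      Real.cos (π / 4) * clipE i h = 1 := by
  have hbs := boundary_sum (V := clipV i h) clipV_upper (hvOrigin_mem_clipV i h)
  rw [edir_wOut_hvOrigin, Finset.sum_filter] at hbs
  have hsubT : clipV i h ⊆ triV i := clipV_subset i h
  have hsubS : clipV i h ⊆ stripV (2 * i + 1) i := hsubT.trans (triV_subset_stripV le_rfl le_rfl)
  have hpt : ∀ P ∈ midWalks (clipV i h),
      ((if P ≠ [wOut, hvOrigin] ∧ (finalDart P).2 ∉ clipV i h then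
          edir (finalDart P).1 (finalDart P).2 * pwt P else 0) / emb (-1, 2)).re =
        hexCriticalFugacity ^ mwLen P *
          ((if IsAlphaDart (finalDart P) then Real.cos (3 * π / 8) else 0) +
            (if IsLeftDart i (finalDart P) then Real.cos (π / 8) else 0) +
            (if IsRightDart i (finalDart P) then Real.cos (π / 8) else 0) +
            (if IsClipDart h (finalDart P) then Real.cos (π / 4) else 0)) := by
    intro P hP
    rw [mem_midWalks_iff] at hP
    have hiff := clip_boundary_iff hP
    by_cases hα : IsAlphaDart (finalDart P)
    · rw [if_pos (hiff.2 (Or.inl hα)), re_div_e₀, boundaryTerm_re_of_isAlphaDart (hP.mono hsubS) hα,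
        if_pos hα, if_neg (not_isLeftDart_of_isAlphaDart hα),
        if_neg (not_isRightDart_of_isAlphaDart hα), if_neg (not_isClipDart_of_eq_false hα.2.1)]
      ring
    by_cases hl : IsLeftDart i (finalDart P)
    · rw [if_pos (hiff.2 (Or.inr (Or.inl hl))), re_div_e₀,
        boundaryTerm_re_of_isLeftDart (hP.mono hsubT) hl, if_neg hα, if_pos hl,
        if_neg (not_isRightDart_of_isLeftDart hl), if_neg (not_isClipDart_of_eq_false hl.2.1)]
      ring
    by_cases hr : IsRightDart i (finalDart P)
    · rw [if_pos (hiff.2 (Or.inr (Or.inr (Or.inl hr)))), re_div_e₀,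
        boundaryTerm_re_of_isRightDart (hP.mono hsubT) hr, if_neg hα, if_neg hl, if_pos hr,
        if_neg (not_isClipDart_of_eq_false hr.2.1)]
      ring
    by_cases hc : IsClipDart h (finalDart P)
    · rw [if_pos (hiff.2 (Or.inr (Or.inr (Or.inr hc)))), re_div_e₀,
        boundaryTerm_re_of_isClipDart hP hc, if_neg hα, if_neg hl, if_neg hr, if_pos hc]
      ring
    · rw [if_neg (by rw [hiff]; push Not; exact ⟨hα, hl, hr, hc⟩), zero_div, Complex.zero_re,
        if_neg hα, if_neg hl, if_neg hr, if_neg hc]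
      ring
  have key := congrArg (fun z => (z / emb (-1, 2)).re) hbs
  rw [div_self emb_neg_one_two_ne_zero, Complex.one_re, Finset.sum_div, Complex.re_sum,
    Finset.sum_congr rfl hpt] at key
  have hA : ∑ P ∈ midWalks (clipV i h), hexCriticalFugacity ^ mwLen P *
      (if IsAlphaDart (finalDart P) then Real.cos (3 * π / 8) else 0) =
        Real.cos (3 * π / 8) * clipA i h := by
    rw [clipA, Finset.mul_sum, Finset.sum_filter]
    refine Finset.sum_congr rfl fun P _ => ?_
    split_ifs <;> ring
  have hDl : ∑ P ∈ midWalks (clipV i h), hexCriticalFugacity ^ mwLen P *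
      (if IsLeftDart i (finalDart P) then Real.cos (π / 8) else 0) =
        Real.cos (π / 8) * clipDl i h := by
    rw [clipDl, Finset.mul_sum, Finset.sum_filter]
    refine Finset.sum_congr rfl fun P _ => ?_
    split_ifs <;> ring
  have hDr : ∑ P ∈ midWalks (clipV i h), hexCriticalFugacity ^ mwLen P *
      (if IsRightDart i (finalDart P) then Real.cos (π / 8) else 0) =
        Real.cos (π / 8) * clipDr i h := by
    rw [clipDr, Finset.mul_sum, Finset.sum_filter]
    refine Finset.sum_congr rfl fun P _ => ?_
    split_ifs <;> ring
  have hE : ∑ P ∈ midWalks (clipV i h), hexCriticalFugacity ^ mwLen P *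
      (if IsClipDart h (finalDart P) then Real.cos (π / 4) else 0) =
        Real.cos (π / 4) * clipE i h := by
    rw [clipE, Finset.mul_sum, Finset.sum_filter]
    refine Finset.sum_congr rfl fun P _ => ?_
    split_ifs <;> ring
  rw [mul_add, ← key, ← hA, ← hDl, ← hDr, ← hE, ← Finset.sum_add_distrib, ← Finset.sum_add_distrib,
    ← Finset.sum_add_distrib]
  refine Finset.sum_congr rfl fun P _ => ?_
  ring

/-! ### Splitting the right exits of `T_i` along the cut, and KP's bound `F^B ≥ (cos(π/8)/cos(π/4)) D⁻` -/

/-- The walks of `C(i,h)` are the walks of `T_i` none of whose inner vertices lies beyond the cut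
("any walk contained in `Trap_{2i+1,x}` is also contained in `Tria_{2i+1,x}`").
[cite: KrachunPanagiotis2026, proof of Lemma 3.2] -/
theorem midWalks_clipV_eq_filter (i h : ℕ) :
    midWalks (clipV i h) =
      (midWalks (triV i)).filter fun P => ¬ ∃ v ∈ HV.inner P, (h : ℤ) + 1 ≤ v.1 := by
  ext P
  rw [mem_filter, mem_midWalks_iff, mem_midWalks_iff]
  constructor
  · intro hP
    refine ⟨hP.mono (clipV_subset i h), ?_⟩
    rintro ⟨v, hv, hv1⟩
    have := (mem_clipV_iff.1 (hP.2.2.2.1 v hv)).2.2.2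
    omega
  · rintro ⟨hP, hV⟩
    refine ⟨hP.1, hP.2.1, hP.2.2.1, fun x hx => ?_, hP.2.2.2.2.1, hP.2.2.2.2.2⟩
    rw [clipV, mem_filter]
    refine ⟨hP.2.2.2.1 x hx, ?_⟩
    by_contra hx1
    exact hV ⟨x, hx, by omega⟩

/-- **`triDr i = clipDr i h + triDminus i h`**: a walk of `T_i` to its right side either stays in the
clipped triangle (then it is a right exit of `C(i,h)`) or visits a cell beyond the cut (KP's
`D⁻_{2i+1,x}`: "any walk contributing to `D⁻` is contained in `Tria` but not in `Trap`").
[cite: KrachunPanagiotis2026, proof of Lemma 3.2 (D − F^R − F^T ≥ D⁻)] -/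
theorem triDr_eq_clipDr_add_triDminus (i h : ℕ) : triDr i = clipDr i h + triDminus i h := by
  have hsplit := Finset.sum_filter_add_sum_filter_not (rightWalks i)
    (fun P => ∃ v ∈ HV.inner P, (h : ℤ) + 1 ≤ v.1) (fun P => hexCriticalFugacity ^ mwLen P)
  rw [triDr_eq_sum_rightWalks, ← hsplit, add_comm]
  congr 1
  · simp only [clipDr, rightWalks, midWalks_clipV_eq_filter, Finset.filter_filter]
    exact Finset.sum_congr (Finset.filter_congr fun P _ => by tauto) fun _ _ => rfl
  · simp only [triDminus, rightWalks, Finset.filter_filter]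

/-- `clipA ≤ triA i` (`F^L ≤ A`: "any walk contained in `Trap` is also contained in `Tria`").
[cite: KrachunPanagiotis2026, proof of Lemma 3.2 (A − F^L ≥ 0)] -/
theorem clipA_le_triA (i h : ℕ) : clipA i h ≤ triA i := by
  unfold clipA triA
  apply sum_le_sum_of_subset_of_nonneg
  · intro P hP
    rw [mem_filter] at hP ⊢
    exact ⟨midWalks_mono (clipV_subset i h) hP.1, hP.2⟩
  · exact fun _ _ _ => pow_nonneg hexCriticalFugacity_pos_lt_one.1.le _

/-- `clipDl ≤ triDl i` (`F^T ≤` the left exits of `Tria`).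
[cite: KrachunPanagiotis2026, proof of Lemma 3.2 (D − F^R − F^T ≥ D⁻)] -/
theorem clipDl_le_triDl (i h : ℕ) : clipDl i h ≤ triDl i := by
  unfold clipDl triDl
  apply sum_le_sum_of_subset_of_nonneg
  · intro P hP
    rw [mem_filter] at hP ⊢
    exact ⟨midWalks_mono (clipV_subset i h) hP.1, hP.2⟩
  · exact fun _ _ _ => pow_nonneg hexCriticalFugacity_pos_lt_one.1.le _

/-- **Krachun–Panagiotis, proof of Lemma 3.2: `F^B ≥ (cos(π/8)/cos(π/4)) D⁻`**, i.e.
`cos(π/8)·triDminus i h ≤ cos(π/4)·clipE i h`: subtract the trapezoid identity from the triangle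
identity `HV.tri_identity` and use `clipA ≤ triA`, `clipDl ≤ triDl`, `triDr − clipDr = triDminus`.
[cite: KrachunPanagiotis2026, proof of Lemma 3.2 ("F^B ≥ (cos(π/8)/cos(π/4)) D⁻")] -/
theorem triDminus_le_clipE (i h : ℕ) :
    Real.cos (π / 8) * triDminus i h ≤ Real.cos (π / 4) * clipE i h := by
  have h1 := clip_identity i h
  have h2 := tri_identity i
  have h3 : Real.cos (π / 8) * triDr i =
      Real.cos (π / 8) * clipDr i h + Real.cos (π / 8) * triDminus i h := by
    rw [triDr_eq_clipDr_add_triDminus i h]; ring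
  have hA := mul_le_mul_of_nonneg_left (clipA_le_triA i h) cos_three_pi_div_eight_pos.le
  have hD := mul_le_mul_of_nonneg_left (clipDl_le_triDl i h) cos_pi_div_eight_pos.le
  linarith

/-- **Registered sub-goal `stub_kp_clip_identity`** (crux item stmt-CriticalPhenomena-0808, line
`root-locality-replaces-loewner`): the parafermionic identity of the clipped triangle
`C(i,h) = T_i ∩ {x₀ ≤ h}` (Krachun–Panagiotis's trapezoid `Trap_{2i+1,x}` in the frame of the attached
triangle), the splitting `triDr i = clipDr i h + triDminus i h` of the right exits of `T_i` along the
cut, and KP's bound `cos(π/8)·D⁻ ≤ cos(π/4)·F^B`.  No hypothesis on `h` is needed (for `h ≥ i` the cut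
class is empty and the identity is `HV.tri_identity`).
[cite: KrachunPanagiotis2026, proof of Lemma 3.2] -/
theorem stub_kp_clip_identity : ∀ (i h : ℕ), Real.cos (3 * Real.pi / 8) * clipA i h + Real.cos (Real.pi / 8) * (clipDl i h + clipDr i h) + Real.cos (Real.pi / 4) * clipE i h = 1 ∧ Literature.Probability.RandomPlanarGeometry.SAW.HV.triDr i = clipDr i h + triDminus i h ∧ Real.cos (Real.pi / 8) * triDminus i h ≤ Real.cos (Real.pi / 4) * clipE i h :=
  fun i h => ⟨clip_identity i h, triDr_eq_clipDr_add_triDminus i h, triDminus_le_clipE i h⟩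

end Summit.CriticalPhenomena.SAWScalingLimit.Theorems.HexConjecture.RootLocality

end
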